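import Summits.KontsevichZagierPeriods.KontsevichZagierPeriods.Theorems.RootDecompRelativeModAbsoluteAngleFoldP9
import Summits.KontsevichZagierPeriods.KontsevichZagierPeriods.Theorems.RootDecompRelativeModAbsoluteCircleSplitP08
import Summits.KontsevichZagierPeriods.KontsevichZagierPeriods.Theorems.RootDecompRelativeModAbsoluteCylLogSplitP50
import Summits.KontsevichZagierPeriods.KontsevichZagierPeriods.Theorems.RootDecompRelativeModAbsoluteCircleLogP7
import Summits.KontsevichZagierPeriods.KontsevichZagierPeriods.Theorems.RootDecompRelativeModAbsoluteCylLogSplitP23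
import Literature.NumberTheory.Transcendental.SemialgebraicAlgebraicPoints
import Literature.NumberTheory.Transcendental.KZLogCalculusProofs
import Literature.NumberTheory.Transcendental.KZSemiCanonicalReductionProofs
import Literature.NumberTheory.Transcendental.KZDominatedFamilyRelations
import Literature.NumberTheory.Transcendental.KZSemialgebraicComplex
import Literature.NumberTheory.Transcendental.SemialgebraicLineDeriv
import Literature.ModelTheory.ExponentialFields.CylindricalDecompositionProofs
import Literature.NumberTheory.Transcendental.KZTameMoveFamily
import Literature.NumberTheory.Transcendental.KZTorusLogRep
import Mathlib.Analysis.SpecialFunctions.Trigonometric.ArctanDeriv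
import Mathlib.Tactic.LinearCombination
import Mathlib.Tactic.Module

/-! # `RootDecompRelativeModAbsoluteEvenCircleP1` — part 1/10 of the mechanical ≤400-line split of `evB_src3.lean` (sha256 9b9fc462830f2800…)
Source: decomp-kz lens-3 g14 EvenCircle.lean FINAL @ba0f3b57 §K0–§K12 (land/EvenCircleB @954ab641, lint-fixed, §K12 re-pointed at the landed CircleSplit names; critic CLEARED g7-2 l.1388: evenCircleCellClose_holds); --supports stmt-KontsevichZagierPeriods-30572.
Split by census-1 g10 `gen/splitlean.py`: scopes re-opened with their `open`/`variable`/`set_option` context; mathematics and declaration order unchanged. -/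

/-! # EvenCircle §K0–§K12 (decomp-kz lens-3 g14 `land/EvenCircleB.lean` @954ab641 = `EvenCircle.lean` FINAL @ba0f3b57 minus its AngleFold prefix;
critic CLEARED g7-2 l.1388: RESIDUAL `EvenCircleCellClose` PROVED): engines (`gk/qk/Qk/Gn`, `integral_circ_fibre`, `dec_piece_circ`, `rgn_newton`,
`inc_piece_circ`, `circ_kernel_split`, `edge_package_circ`), `half_top_even`/`half_bot_even`, cells, normalisation, `evenCircle_bdd`, `evenCircle_out`, `evenCircleK`,
and the §K12 bridge re-pointed at the landed `…CircleSplitP01/P08` names. --supports stmt-KontsevichZagierPeriods-30572. -/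

/-! # EvenCircle (g14 → g15): first engines for the residual `EvenCircleCellClose` (BLUEPRINT-wild.md §2), as a
continuation of `AngleFold.lean` (same imports; its §A–§F engines are reused).  THIS FILE: §K0 the circle kernel
`g_n(s) = s^{2n}/(1+s²)`, its primitive `Gn`, the polynomial/arctangent split and the closed form; §K1 honest unfolded
circle-kernel bands; §K2 the substitution piece for an edge DECREASING towards the top end of a half-cell — INCLUDING THE
WILD END `u → 0⁺` (constant band null, no `L¹` condition on the coefficient: honesty of the Jacobian piece is transported). -/

noncomputable section

open Set MeasureTheory
open Literature.NumberTheory.Transcendental Literature.ModelTheory.ExponentialFields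

namespace Summit.KontsevichZagierPeriods.RootDecompRelativeModAbsolute.Rung30571.RegularisedLogLayer.CylLog.Leaf.G13

namespace AngleFold

/-! ### §K0 The circle kernel and its primitive. -/

/-- The circle kernel of half-order `n`: `g_n(s) = s^{2n}/(1+s²)`. -/
def gk (n : ℕ) (s : ℝ) : ℝ := s ^ (2 * n) / (1 + s ^ 2)

/-- The polynomial quotient `q_n(s)`: `q_0 = 0`, `q_{n+1}(s) = s^{2n} − q_n(s)`; `(1+s²) q_n(s) = s^{2n} − (−1)^n`. -/
def qk : ℕ → ℝ → ℝ
  | 0, _ => 0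
  | n + 1, s => s ^ (2 * n) - qk n s

/-- Its odd primitive `Q_n`: `Q_0 = 0`, `Q_{n+1}(v) = v^{2n+1}/(2n+1) − Q_n(v)`. -/
def Qk : ℕ → ℝ → ℝ
  | 0, _ => 0
  | n + 1, v => v ^ (2 * n + 1) / ((2 * n : ℕ) + 1 : ℝ) - Qk n v

/-- Auxiliary step `one_add_sq_mul_qk` (§K0): one add sq mul qk. [bookkeeping] -/
theorem one_add_sq_mul_qk (n : ℕ) (s : ℝ) : (1 + s ^ 2) * qk n s = s ^ (2 * n) - (-1) ^ n := by
  induction n with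
  | zero => simp [qk]
  | succ n ih =>
    show (1 + s ^ 2) * (s ^ (2 * n) - qk n s) = _
    rw [mul_sub, ih]
    ring

/-- Auxiliary step `gk_eq` (§K0): gk eq. [bookkeeping] -/
theorem gk_eq (n : ℕ) (s : ℝ) : gk n s = qk n s + (-1) ^ n / (1 + s ^ 2) := by
  have h : (1 + s ^ 2) ≠ 0 := by positivity
  have e : s ^ (2 * n) = (1 + s ^ 2) * qk n s + (-1) ^ n := by rw [one_add_sq_mul_qk]; ring
  rw [gk, e, add_div, mul_div_cancel_left₀ _ h]

/-- Auxiliary step `gk_nonneg` (§K0): gk nonneg. [bookkeeping] -/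
theorem gk_nonneg (n : ℕ) (s : ℝ) : 0 ≤ gk n s := by
  unfold gk
  have : 0 ≤ s ^ (2 * n) := by rw [pow_mul]; positivity
  positivity

/-- Auxiliary step `gk_le` (§K0): gk le. [bookkeeping] -/
theorem gk_le (n : ℕ) {s : ℝ} (hs : 0 ≤ s) {c : ℝ} (hsc : s ≤ c) : gk n s ≤ c ^ (2 * n) := by
  unfold gk
  have h1 : s ^ (2 * n) ≤ c ^ (2 * n) := pow_le_pow_left₀ hs hsc _
  have h2 : (1:ℝ) ≤ 1 + s ^ 2 := by nlinarith
  have h0 : 0 ≤ s ^ (2 * n) := pow_nonneg hs _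
  calc s ^ (2 * n) / (1 + s ^ 2) ≤ s ^ (2 * n) / 1 := div_le_div_of_nonneg_left h0 one_pos h2
    _ ≤ c ^ (2 * n) := by rw [div_one]; exact h1

/-- Auxiliary step `continuous_gk` (§K0): continuous gk. [bookkeeping] -/
theorem continuous_gk (n : ℕ) : Continuous (gk n) := by
  unfold gk
  exact (continuous_pow _).div (by fun_prop) fun s => by positivity

/-- Auxiliary step `hasDerivAt_Qk` (§K0): has Deriv At Qk. [bookkeeping] -/
theorem hasDerivAt_Qk (n : ℕ) (v : ℝ) : HasDerivAt (Qk n) (qk n v) v := by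
  induction n with
  | zero => simpa [Qk, qk] using hasDerivAt_const v (0:ℝ)
  | succ n ih =>
    have h1 : HasDerivAt (fun v : ℝ => v ^ (2 * n + 1) / ((2 * n : ℕ) + 1 : ℝ)) (v ^ (2 * n)) v := by
      have hne : ((2 * n : ℕ) + 1 : ℝ) ≠ 0 := by positivity
      refine ((hasDerivAt_pow (2 * n + 1) v).div_const ((2 * n : ℕ) + 1 : ℝ)).congr_deriv ?_
      rw [Nat.add_sub_cancel]; push_cast; field_simp
    show HasDerivAt (fun v => v ^ (2 * n + 1) / ((2 * n : ℕ) + 1 : ℝ) - Qk n v) (v ^ (2 * n) - qk n v) v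
    exact h1.sub ih

/-- Auxiliary step `Qk_zero_right` (§K0): Qk zero right. [bookkeeping] -/
theorem Qk_zero_right (n : ℕ) : Qk n 0 = 0 := by
  induction n with
  | zero => rfl
  | succ n ih => simp [Qk, ih]

/-- Auxiliary step `continuous_Qk` (§K0): continuous Qk. [bookkeeping] -/
theorem continuous_Qk (n : ℕ) : Continuous (Qk n) :=
  continuous_iff_continuousAt.2 fun v => (hasDerivAt_Qk n v).continuousAt

/-- The primitive `G_n(c) = ∫₀^c g_n` as an interval integral. -/
def Gn (n : ℕ) (c : ℝ) : ℝ := ∫ t in (0:ℝ)..c, gk n t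

/-- Auxiliary step `hasDerivAt_Gn` (§K0): has Deriv At Gn. [bookkeeping] -/
theorem hasDerivAt_Gn (n : ℕ) (c : ℝ) : HasDerivAt (Gn n) (gk n c) c := by
  unfold Gn
  exact intervalIntegral.integral_hasDerivAt_right ((continuous_gk n).intervalIntegrable _ _)
    ((continuous_gk n).stronglyMeasurableAtFilter _ _) (continuous_gk n).continuousAt

/-- Auxiliary step `Gn_zero_right` (§K0): Gn zero right. [bookkeeping] -/
theorem Gn_zero_right (n : ℕ) : Gn n 0 = 0 := by simp [Gn]

/-- Auxiliary step `continuous_Gn` (§K0): continuous Gn. [bookkeeping] -/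
theorem continuous_Gn (n : ℕ) : Continuous (Gn n) :=
  continuous_iff_continuousAt.2 fun v => (hasDerivAt_Gn n v).continuousAt

/-- Auxiliary step `Gn_monotone` (§K0): Gn monotone. [bookkeeping] -/
theorem Gn_monotone (n : ℕ) : Monotone (Gn n) :=
  monotone_of_hasDerivAt_nonneg (fun c => hasDerivAt_Gn n c) fun c => gk_nonneg n c

/-- Auxiliary step `Gn_nonneg` (§K0): Gn nonneg. [bookkeeping] -/
theorem Gn_nonneg (n : ℕ) {c : ℝ} (hc : 0 ≤ c) : 0 ≤ Gn n c := by
  simpa [Gn_zero_right] using Gn_monotone n hc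

/-- **Closed form**: `G_n(c) = Q_n(c) + (−1)^n arctan c`. -/
theorem Gn_eq (n : ℕ) (c : ℝ) : Gn n c = Qk n c + (-1) ^ n * Real.arctan c := by
  have h : ∀ v, HasDerivAt (fun v => Gn n v - (Qk n v + (-1) ^ n * Real.arctan v)) 0 v := by
    intro v
    have h1 : HasDerivAt (fun v => Gn n v - (Qk n v + (-1) ^ n * Real.arctan v))
        (gk n v - (qk n v + (-1) ^ n * (1 / (1 + v ^ 2)))) v :=
      (hasDerivAt_Gn n v).sub ((hasDerivAt_Qk n v).add ((Real.hasDerivAt_arctan v).const_mul ((-1:ℝ) ^ n)))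
    refine h1.congr_deriv ?_
    rw [gk_eq]; ring
  have hc := is_const_of_deriv_eq_zero (f := fun v => Gn n v - (Qk n v + (-1) ^ n * Real.arctan v))
    (fun v => (h v).differentiableAt) (fun v => (h v).deriv) c 0
  simp [Gn_zero_right, Qk_zero_right] at hc
  linarith

/-- The scaled fibre integral: `∫₀¹ θ^{2n}/(1+θ²u²) dθ = G_n(u)/u^{2n+1}` (`u > 0`). -/
theorem integral_circ_fibre (n : ℕ) {u : ℝ} (hu : 0 < u) :
    ∫ θ in Set.Ioo (0:ℝ) 1, θ ^ (2 * n) / (1 + θ ^ 2 * u ^ 2) = Gn n u / u ^ (2 * n + 1) := by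
  have hsub := intervalIntegral.integral_comp_mul_deriv' (a := (0:ℝ)) (b := 1) (f := fun θ : ℝ => θ * u)
    (f' := fun _ : ℝ => u) (g := fun s : ℝ => gk n s / u ^ (2 * n + 1))
    (fun θ _ => by simpa using (hasDerivAt_id θ).mul_const u)
    continuousOn_const (((continuous_gk n).div_const _).continuousOn)
  simp only [Function.comp, zero_mul, one_mul] at hsub
  rw [← integral_Ioc_eq_integral_Ioo, ← intervalIntegral.integral_of_le zero_le_one]
  have hL : ∫ θ in (0:ℝ)..1, θ ^ (2 * n) / (1 + θ ^ 2 * u ^ 2) =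
      ∫ θ in (0:ℝ)..1, gk n (θ * u) / u ^ (2 * n + 1) * u := by
    refine intervalIntegral.integral_congr fun θ _ => ?_
    have hu' : u ^ (2 * n + 1) ≠ 0 := pow_ne_zero _ hu.ne'
    simp only [gk, mul_pow]
    field_simp
    ring
  rw [hL, hsub, Gn, intervalIntegral.integral_div]

/-! ### §K1 Honest unfolded circle-kernel bands `[band G 0 u, q·g_n(t)]`. -/

/-- Fibre bound: `∫⁻_{[0,c]} ‖q g_n(t)‖ ≤ ‖q·G_n(c)‖` (`c ≥ 0`). -/
theorem lintegral_circKernel_le (q : ℝ) (n : ℕ) {c : ℝ} (hc : 0 ≤ c) :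
    ∫⁻ t in Icc 0 c, ‖q * gk n t‖ₑ ≤ ‖q * Gn n c‖ₑ := by
  have hcont : ContinuousOn (fun t : ℝ => q * gk n t) (Icc 0 c) :=
    (continuous_const.mul (continuous_gk n)).continuousOn
  have hg_int : IntegrableOn (fun t : ℝ => q * gk n t) (Icc 0 c) := hcont.integrableOn_compact isCompact_Icc
  have hL : ∫⁻ t in Icc 0 c, ‖q * gk n t‖ₑ = ENNReal.ofReal (∫ t in Icc 0 c, ‖q * gk n t‖) :=
    (ofReal_integral_norm_eq_lintegral_enorm hg_int).symm
  have hG0 : 0 ≤ Gn n c := Gn_nonneg n hc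
  have hK0 : 0 ≤ |q| * Gn n c := mul_nonneg (abs_nonneg _) hG0
  rw [hL, show ‖q * Gn n c‖ₑ = ENNReal.ofReal (|q| * Gn n c) by
    rw [← Real.enorm_eq_ofReal hK0]
    simp [enorm_mul, Real.enorm_eq_ofReal_abs, abs_of_nonneg hG0]]
  refine ENNReal.ofReal_le_ofReal (le_of_eq ?_)
  have heq : EqOn (fun t : ℝ => ‖q * gk n t‖) (fun t => |q| * gk n t) (Icc 0 c) := fun t _ => by
    show ‖q * gk n t‖ = |q| * gk n t
    rw [Real.norm_eq_abs, abs_mul, abs_of_nonneg (gk_nonneg n t)]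
  rw [setIntegral_congr_fun measurableSet_Icc heq, integral_Icc_eq_integral_Ioc,
    ← intervalIntegral.integral_of_le hc, intervalIntegral.integral_const_mul]
  rfl

/-- Auxiliary step `sa_gk_last` (§K1): sa gk last. [bookkeeping] -/
theorem sa_gk_last {m : ℕ} {B : Set (Fin (m + 1) → ℝ)} (hB : IsSemialgebraic ℚ B) (n : ℕ) :
    IsSemialgebraicFunOn ℚ B (fun z => gk n (z (Fin.last m))) := by
  have hl : IsSemialgebraicFunOn ℚ B (fun z => z (Fin.last m)) :=
    Literature.NumberTheory.Transcendental.isSemialgebraicFunOn_apply hB (Fin.last m)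
  have h1 : IsSemialgebraicFunOn ℚ B (fun _ => (1:ℝ)) := (isSemialgebraicFunOn_ratCast hB 1).congr fun _ _ => by simp
  have hden : IsSemialgebraicFunOn ℚ B (fun z => 1 + z (Fin.last m) ^ 2) := IsSemialgebraicFunOn.add_holds h1 (hl.fun_pow 2)
  have hq : IsSemialgebraicFunOn ℚ B (fun z => z (Fin.last m) ^ (2 * n) / (1 + z (Fin.last m) ^ 2)) :=
    IsSemialgebraicFunOn.div (hl.fun_pow (2 * n)) hden fun z _ => by positivity
  exact hq.congr fun z _ => by simp [gk]

/-- Auxiliary step `sa_circKernel` (§K1): sa circ Kernel. [bookkeeping] -/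
theorem sa_circKernel {B : Set (Fin 2 → ℝ)} (hB : IsSemialgebraic ℚ B) {T : Set (Fin 1 → ℝ)}
    (hBT : B ⊆ {z | Fin.init z ∈ T}) {p : (Fin 1 → ℝ) → ℝ} (hp : IsSemialgebraicFunOn ℚ T p) (n : ℕ) :
    IsSemialgebraicFunOn ℚ B (fun z => p (Fin.init z) * gk n (z (Fin.last 1))) :=
  (hp.comp_init.mono hBT hB).mul_holds (sa_gk_last hB n)

/-- **Honesty of an unfolded circle monomial from the base bound** `q·G_n(u) ∈ L¹(G)`. -/
theorem integrableOn_circKernel_band {m : ℕ} {G : Set (Fin m → ℝ)} {u q : (Fin m → ℝ) → ℝ}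
    (hG : IsSemialgebraic ℚ G) (hu : IsSemialgebraicFunOn ℚ G u) (hq : IsSemialgebraicFunOn ℚ G q) (n : ℕ)
    (hu0 : ∀ y ∈ G, 0 ≤ u y) (hint : IntegrableOn (fun y => q y * Gn n (u y)) G) :
    IntegrableOn (fun z : Fin (m + 1) → ℝ => q (Fin.init z) * gk n (z (Fin.last m)))
      (KZlog.band G (fun _ => 0) u) := by
  have h0sa : IsSemialgebraicFunOn ℚ G (fun _ => (0:ℝ)) := (isSemialgebraicFunOn_ratCast hG 0).congr fun _ _ => by simp
  have hbsa : IsSemialgebraic ℚ (KZlog.band G (fun _ => (0:ℝ)) u) := KZlog.isSemialgebraic_band h0sa hu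
  have hGm : MeasurableSet G := hG.measurableSet_holds
  have hBm : MeasurableSet (KZlog.band G (fun _ => (0:ℝ)) u) := hbsa.measurableSet_holds
  have hgsa : IsSemialgebraicFunOn ℚ (KZlog.band G (fun _ => (0:ℝ)) u) (fun z => gk n (z (Fin.last m))) :=
    sa_gk_last hbsa n
  have hRsa : IsSemialgebraicFunOn ℚ (KZlog.band G (fun _ => (0:ℝ)) u)
      (fun z => q (Fin.init z) * gk n (z (Fin.last m))) := (hq.comp_init.mono (fun z hz => hz.1) hbsa).mul_holds hgsa
  refine KZlog.integrableOn_band_of_lintegral_fibre_le hGm (a := fun _ => (0:ℝ)) (b := u) hBm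
    (fun x t => KZlog.snoc_mem_band) (KZ.aestronglyMeasurable_of_isSemialgebraicFunOn hRsa hBm)
    (K := fun x => q x * Gn n (u x)) (fun x hx => ?_) hint
  simp only [Fin.init_snoc, Fin.snoc_last]
  exact lintegral_circKernel_le (q x) n (hu0 x hx)

/-- The honest unfolded circle monomial `[band G 0 u, q·g_n(t)]`. -/
def circRep {m : ℕ} {G : Set (Fin m → ℝ)} {u q : (Fin m → ℝ) → ℝ}
    (hG : IsSemialgebraic ℚ G) (hu : IsSemialgebraicFunOn ℚ G u) (hq : IsSemialgebraicFunOn ℚ G q) (n : ℕ)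
    (hu0 : ∀ y ∈ G, 0 ≤ u y) (hint : IntegrableOn (fun y => q y * Gn n (u y)) G) : KZ.IntegralRep (m + 1) where
  domain := KZlog.band G (fun _ => 0) u
  integrand := fun z => q (Fin.init z) * gk n (z (Fin.last m))
  isSemialgebraic_domain := KZlog.isSemialgebraic_band
    ((isSemialgebraicFunOn_ratCast hG 0).congr fun _ _ => by simp) hu
  isSemialgebraicFunOn_integrand := by
    have hbsa : IsSemialgebraic ℚ (KZlog.band G (fun _ => (0:ℝ)) u) :=
      KZlog.isSemialgebraic_band ((isSemialgebraicFunOn_ratCast hG 0).congr fun _ _ => by simp) hu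
    exact (hq.comp_init.mono (fun z hz => hz.1) hbsa).mul_holds (sa_gk_last hbsa n)
  integrableOn := integrableOn_circKernel_band hG hu hq n hu0 hint

/-! ### §K2 The substitution piece for an edge DECREASING towards the top end — including the WILD end `u → 0⁺`. -/

/-- The Jacobian integrand `p(x) g_n(u(ξ)) u'(ξ)` on the substitution region. -/
def wcirc (p u : (Fin 1 → ℝ) → ℝ) (n : ℕ) (z : Fin 2 → ℝ) : ℝ :=
  p (Fin.init z) * gk n (u (bpt (z (Fin.last 1)))) * du u (bpt (z (Fin.last 1)))

/-- Auxiliary step `sa_wcirc` (§K2): sa wcirc. [bookkeeping] -/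
theorem sa_wcirc {T : Set (Fin 1 → ℝ)} (hT : IsSemialgebraic ℚ T) (hTo : IsOpen T) (n : ℕ) {p u : (Fin 1 → ℝ) → ℝ}
    (hp : IsSemialgebraicFunOn ℚ T p) (hu : IsSemialgebraicFunOn ℚ T u) (hud : ∀ x ∈ T, DifferentiableAt ℝ u x) :
    IsSemialgebraicFunOn ℚ (Rgn T) (wcirc p u n) := by
  have hRsa := isSemialgebraic_Rgn hT
  have hR2 : Rgn T ⊆ {z | bpt (z (Fin.last 1)) ∈ T} := fun z hz => hz.2.1
  have hub : IsSemialgebraicFunOn ℚ (Rgn T) (fun z => u (bpt (z (Fin.last 1)))) :=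
    (sa_comp_bpt hu (Fin.last 1)).mono hR2 hRsa
  refine ((sa_wfun hT hTo hp hu hud).mul_holds (hub.fun_pow (2 * n))).congr fun z _ => ?_
  have h : (1 + u (bpt (z (Fin.last 1))) ^ 2) ≠ 0 := by positivity
  rw [Pi.mul_apply]
  simp only [wcirc, wfun, gk]
  field_simp

end AngleFold
end Summit.KontsevichZagierPeriods.RootDecompRelativeModAbsolute.Rung30571.RegularisedLogLayer.CylLog.Leaf.G13
end
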